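import Literature.Algebra.EuclideanLattices.RankinSublattice
import Literature.NumberTheory.DiophantineGeometry.BrightAbcTriples
import HarnessLib

/-!
# Bright's kernel sublattice of the prime-number lattice and his Lemma 3.1

Topic `Literature/NumberTheory/DiophantineGeometry`. Everything in this file is PROVED (no named
facts, no definitions).

C. Bright, *A new lower bound in the abc conjecture*, Canad. Math. Bull. 67 (2024), §2.1–2.4 and
Lemma 3.1. For distinct odd primes `p_0, …, p_{n-1}` (`n ≥ 1`) let `L ⊆ ℝ^{n+1}` be the lattice
with basis rows `b_i = log p_i (e_i + e_n)` (`i < n`) and `b_n = n³ e_n` (§2.1, §2.4: the extra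
row makes the lattice full-rank; `det = n³ ∏ log p_i`, Lemma 2.5), and let `L_m ⊆ L` be the
*kernel sublattice* of the vectors `∑ e_i b_i` with `∏_{i<n} p_i^{e_i} ≡ 1 (mod 2^m)` (§2.2), of
index `≤ |(ℤ/2^m)ˣ| = 2^{m-1}`. Rankin's bound on `L_m`
(`Literature.Algebra.EuclideanLattices.Rankin.exists_mem_ne_zero_l1_le_of_finiteIndex`) yields a
non-zero `v = ∑ e_i b_i ∈ L_m` with `‖v‖₁ ≤ B`, `B` the Rankin bound for covolume
`2^{m-1} n³ ∏ log p_i`; if `B < n³` then `e_n = 0` (Lemma 2.7: `‖v‖₁ ≥ n³ |e_n|`), so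
`‖v‖₁ = ∑_{i<n} |e_i| log p_i + |∑_{i<n} e_i log p_i| = 2 log c` for the abc triple of
`Literature.NumberTheory.DiophantineGeometry.exists_abcTriple_of_prod_pow_modEq`, which also has
`2^{m-1} rad(abc) < c ∏ p_i`. This is Lemma 3.1 of the paper in finite form
(`exists_abcTriple_two_mul_log_le_rankinBound`); the asymptotic shape
`2 log c ≤ ((n + O(log n))/δ) (2^{m-1} n³ ∏ log p_i)^{1/(n+1)}` printed there is recovered
downstream by letting `ρ → 1` in Rankin's bound.

## References

* C. Bright, *A new lower bound in the abc conjecture*, Canad. Math. Bull. 67 (2024) 369–378,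
  §2.1–2.4 (Lemmas 2.2, 2.5, 2.7) and Lemma 3.1 [Bright2024].
-/

noncomputable section

open Finset Module

namespace Literature.NumberTheory.DiophantineGeometry

/-! ### The basis matrix (Bright 2024, §2.1 and §2.4) -/

section matrix

variable {n : ℕ} (w : Fin n → ℝ) (d : ℝ)

/-- Row sums of Bright's matrix at a column `j < n`: with rows `b_i = w_i (e_i + e_n)` (`i < n`),
`b_n = d e_n`, the `j`-th coordinate of `∑ e_i b_i` is `e_j w_j`. [cite: Bright2024, §2.1] -/
theorem brightMatrix_sum_castSucc (e : Fin (n + 1) → ℝ) (j : Fin n) :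
    ∑ i, e i * (Matrix.of fun i j : Fin (n + 1) =>
        if h : (i : ℕ) < n then (if (j : ℕ) = i ∨ (j : ℕ) = n then w ⟨i, h⟩ else 0)
        else (if (j : ℕ) = n then d else 0)) i (Fin.castSucc j)
      = e (Fin.castSucc j) * w j := by
  rw [Finset.sum_eq_single (Fin.castSucc j)]
  · simp only [Matrix.of_apply, Fin.val_castSucc, j.isLt, dite_true, true_or, if_true]
  · intro i _ hi
    simp only [Matrix.of_apply, Fin.val_castSucc]
    split_ifs with h1 h2 h3
    · exfalso
      rcases h2 with h2 | h2
      · exact hi (Fin.ext (by simp [h2]))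
      · exact absurd h2 (ne_of_lt j.isLt)
    · ring
    · exact absurd h3 (ne_of_lt j.isLt)
    · ring
  · intro h; exact absurd (Finset.mem_univ _) h

/-- Row sums of Bright's matrix at the last column: the `n`-th coordinate of `∑ e_i b_i` is
`∑_{i<n} e_i w_i + e_n d`. [cite: Bright2024, §2.4] -/
theorem brightMatrix_sum_last (e : Fin (n + 1) → ℝ) :
    ∑ i, e i * (Matrix.of fun i j : Fin (n + 1) =>
        if h : (i : ℕ) < n then (if (j : ℕ) = i ∨ (j : ℕ) = n then w ⟨i, h⟩ else 0)
        else (if (j : ℕ) = n then d else 0)) i (Fin.last n)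
      = ∑ i : Fin n, e (Fin.castSucc i) * w i + e (Fin.last n) * d := by
  rw [Fin.sum_univ_castSucc]
  congr 1
  · refine Finset.sum_congr rfl fun i _ => ?_
    simp only [Matrix.of_apply, Fin.val_castSucc, i.isLt, dite_true, Fin.val_last, or_true,
      if_true]
  · simp only [Matrix.of_apply, Fin.val_last, lt_self_iff_false, dite_false, if_true]

/-- Bright's matrix is upper triangular with diagonal `(w_0, …, w_{n-1}, d)`, so its determinant is
`d ∏ w_i` (Lemma 2.5 of the paper, with `w_i = log p_i`, `d = n³`). [cite: Bright2024, Lemma 2.5] -/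
theorem det_brightMatrix :
    (Matrix.of fun i j : Fin (n + 1) =>
        if h : (i : ℕ) < n then (if (j : ℕ) = i ∨ (j : ℕ) = n then w ⟨i, h⟩ else 0)
        else (if (j : ℕ) = n then d else 0)).det = d * ∏ i, w i := by
  have hdiag : ∀ i : Fin n, (Matrix.of fun i j : Fin (n + 1) =>
        if h : (i : ℕ) < n then (if (j : ℕ) = i ∨ (j : ℕ) = n then w ⟨i, h⟩ else 0)
        else (if (j : ℕ) = n then d else 0)) (Fin.castSucc i) (Fin.castSucc i) = w i := by
    intro i
    simp [Matrix.of_apply, i.isLt]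
  have hlast : (Matrix.of fun i j : Fin (n + 1) =>
        if h : (i : ℕ) < n then (if (j : ℕ) = i ∨ (j : ℕ) = n then w ⟨i, h⟩ else 0)
        else (if (j : ℕ) = n then d else 0)) (Fin.last n) (Fin.last n) = d := by
    simp [Matrix.of_apply]
  rw [Matrix.det_of_upperTriangular]
  · rw [Fin.prod_univ_castSucc, hlast, Finset.prod_congr rfl fun i _ => hdiag i]
    exact mul_comm _ _
  · intro i j hij
    have hij' : (j : ℕ) < i := hij
    simp only [Matrix.of_apply]
    have hi := i.isLt
    have hj := j.isLt
    split_ifs with h1 h2 h3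
    · exfalso
      rcases h2 with h2 | h2 <;> omega
    · rfl
    · exfalso; omega
    · rfl

end matrix

/-! ### The kernel condition as a congruence -/

/-- If `∑ e_i • u_i = 0` in `Additive (ZMod N)ˣ` for the units `u_i` of naturals `p_i` coprime to
`N`, then `∏ p_i^{e_i⁺} ≡ ∏ p_i^{e_i⁻} (mod N)`. [folklore] -/
theorem prod_pow_modEq_of_sum_smul_eq_zero {n N : ℕ} (p : Fin n → ℕ)
    (hcop : ∀ i, (p i).Coprime N) (e : Fin n → ℤ)
    (h : ∑ i, e i • Additive.ofMul (ZMod.unitOfCoprime (p i) (hcop i)) = 0) :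
    (∏ i, p i ^ (e i).toNat) ≡ (∏ i, p i ^ (-e i).toNat) [MOD N] := by
  rw [← ZMod.natCast_eq_natCast_iff]
  set u : Fin n → (ZMod N)ˣ := fun i => ZMod.unitOfCoprime (p i) (hcop i) with hu
  have h1 : ∏ i, (u i) ^ (e i) = 1 := by
    have := congrArg Additive.toMul h
    rwa [toMul_sum, toMul_zero] at this
  have h2 : ∀ i, (u i) ^ (e i) = (u i) ^ (e i).toNat * ((u i) ^ (-e i).toNat)⁻¹ := by
    intro i
    conv_lhs => rw [← Int.toNat_sub_toNat_neg (e i)]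
    rw [zpow_sub, zpow_natCast, zpow_natCast]
  simp_rw [h2] at h1
  rw [Finset.prod_mul_distrib, Finset.prod_inv_distrib, mul_inv_eq_one] at h1
  have h3 := congrArg (fun x : (ZMod N)ˣ => (x : ZMod N)) h1
  simp only [Units.coe_prod, Units.val_pow_eq_pow_val, hu, ZMod.coe_unitOfCoprime] at h3
  push_cast
  exact h3

/-! ### Bright's Lemma 3.1 -/

/-- **Bright 2024, Lemma 3.1 (finite form).** Let `p_0, …, p_{n-1}` (`n ≥ 1`) be distinct odd
primes, `m ≥ 1`, `q > 1`, `0 < ρ < 1`, and let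
`B = (2/(ρ R)) (q · 2^{m-1} n³ ∏ log p_i / ((1 - ρ^q) vol(B_q)))^{1/(n+1)}` be Rankin's `ℓ₁`-bound
(`R^q = ((2q-1)/(q-1))^{q-1} (n+1)^{1-q}`, `vol(B_q) = (2Γ(1/q+1))^{n+1}/Γ((n+1)/q+1)`) for a
lattice of covolume `2^{m-1} n³ ∏ log p_i` in `ℝ^{n+1}`. If `B < n³` there is an abc triple with
`2^{m-1} rad(abc) < c ∏ p_i` and `2 log c ≤ B`: a short vector of the kernel sublattice (index
`≤ 2^{m-1}`, Lemma 2.2; covolume, Lemma 2.5) has vanishing last coefficient (Lemma 2.7) and is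
read off as an `S`-unit `≡ 1 (mod 2^m)` of height `c` (Lemma 2.1).
[cite: Bright2024, Lemma 3.1] -/
theorem exists_abcTriple_two_mul_log_le_rankinBound {n : ℕ} (hn : 1 ≤ n) (p : Fin n → ℕ)
    (hp : ∀ i, (p i).Prime) (hp2 : ∀ i, p i ≠ 2) (hinj : Function.Injective p) {m : ℕ}
    (hm : 1 ≤ m) {q : ℝ} (hq : 1 < q) {ρ : ℝ} (hρ0 : 0 < ρ) (hρ1 : ρ < 1)
    (hB : 2 / (ρ * (((2 * q - 1) / (q - 1)) ^ (q - 1) * ((n + 1 : ℕ) : ℝ) ^ (1 - q)) ^ (1 / q)) *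
        (q * ((2 : ℝ) ^ (m - 1) * ((n : ℝ) ^ 3 * ∏ i, Real.log (p i))) / ((1 - ρ ^ q) *
          ((2 * Real.Gamma (1 / q + 1)) ^ (n + 1) / Real.Gamma ((n + 1 : ℕ) / q + 1))))
          ^ (1 / ((n + 1 : ℕ) : ℝ)) < (n : ℝ) ^ 3) :
    ∃ a b c : ℕ, IsABCTriple a b c ∧ 2 ^ (m - 1) * rad a b c < c * ∏ i, p i ∧
      2 * Real.log c ≤
        2 / (ρ * (((2 * q - 1) / (q - 1)) ^ (q - 1) * ((n + 1 : ℕ) : ℝ) ^ (1 - q)) ^ (1 / q)) *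
        (q * ((2 : ℝ) ^ (m - 1) * ((n : ℝ) ^ 3 * ∏ i, Real.log (p i))) / ((1 - ρ ^ q) *
          ((2 * Real.Gamma (1 / q + 1)) ^ (n + 1) / Real.Gamma ((n + 1 : ℕ) / q + 1))))
          ^ (1 / ((n + 1 : ℕ) : ℝ)) := by
  classical
  -- abbreviations for the constants in Rankin's bound
  set Rρ : ℝ := ρ * (((2 * q - 1) / (q - 1)) ^ (q - 1) * ((n + 1 : ℕ) : ℝ) ^ (1 - q)) ^ (1 / q)
    with hRρ
  set V₁ : ℝ := (2 * Real.Gamma (1 / q + 1)) ^ (n + 1) / Real.Gamma ((n + 1 : ℕ) / q + 1)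
    with hV₁
  have hq0 : 0 < q := by linarith
  have hRρ0 : 0 < Rρ := by
    rw [hRρ]
    refine mul_pos hρ0 (Real.rpow_pos_of_pos (mul_pos ?_ (by positivity)) _)
    exact Real.rpow_pos_of_pos (div_pos (by linarith) (by linarith)) _
  have hV₁0 : 0 < V₁ := by
    rw [hV₁]
    apply div_pos
    · exact pow_pos (mul_pos two_pos (Real.Gamma_pos_of_pos (by positivity))) _
    · exact Real.Gamma_pos_of_pos (by positivity)
  have hρq : ρ ^ q < 1 := Real.rpow_lt_one hρ0.le hρ1 hq0
  have hden0 : 0 < (1 - ρ ^ q) * V₁ := mul_pos (by linarith) hV₁0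
  -- the matrix and the basis
  set w : Fin n → ℝ := fun i => Real.log (p i) with hw
  set d : ℝ := (n : ℝ) ^ 3 with hd
  set M : Matrix (Fin (n + 1)) (Fin (n + 1)) ℝ := Matrix.of fun i j : Fin (n + 1) =>
      if h : (i : ℕ) < n then (if (j : ℕ) = i ∨ (j : ℕ) = n then w ⟨i, h⟩ else 0)
      else (if (j : ℕ) = n then d else 0) with hM
  have hw0 : ∀ i, 0 < w i := fun i => Real.log_pos (by exact_mod_cast (hp i).one_lt)
  have hn0 : (0 : ℝ) < n := by exact_mod_cast hn
  have hd0 : 0 < d := by rw [hd]; positivity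
  have hprodw : 0 < ∏ i, w i := Finset.prod_pos fun i _ => hw0 i
  have hdet : M.det = d * ∏ i, w i := det_brightMatrix w d
  have hdet0 : M.det ≠ 0 := by rw [hdet]; exact (mul_pos hd0 hprodw).ne'
  haveI : Invertible M := Matrix.invertibleOfIsUnitDet M (isUnit_iff_ne_zero.mpr hdet0)
  let b : Basis (Fin (n + 1)) ℝ (Fin (n + 1) → ℝ) :=
    basisOfLinearIndependentOfCardEqFinrank (Matrix.linearIndependent_rows_of_invertible M)
      (by simp)
  have hb : ∀ i, b i = M i := fun i => by
    rw [coe_basisOfLinearIndependentOfCardEqFinrank]; rfl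
  have hbM : Matrix.of ⇑b = M := by
    ext i j
    rw [Matrix.of_apply, hb]
  -- the kernel subgroup
  have hcop : ∀ i, (p i).Coprime (2 ^ m) := fun i =>
    ((Nat.coprime_primes (hp i) Nat.prime_two).mpr (hp2 i)).pow_right m
  set g : Fin n → Additive (ZMod (2 ^ m))ˣ :=
    fun i => Additive.ofMul (ZMod.unitOfCoprime (p i) (hcop i)) with hg
  let φ : (Fin (n + 1) → ℤ) →+ Additive (ZMod (2 ^ m))ˣ :=
    { toFun := fun e => ∑ i : Fin n, e (Fin.castSucc i) • g i
      map_zero' := by simp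
      map_add' := fun e e' => by
        simp only [Pi.add_apply, add_zsmul, Finset.sum_add_distrib] }
  have hφ : ∀ e : Fin (n + 1) → ℤ, φ e = ∑ i : Fin n, e (Fin.castSucc i) • g i := fun e => rfl
  set K : AddSubgroup (Fin (n + 1) → ℤ) := φ.ker with hK
  haveI : Finite φ.range := inferInstance
  haveI : K.FiniteIndex := by rw [hK]; infer_instance
  have hKidx : (K.index : ℝ) ≤ (2 : ℝ) ^ (m - 1) := by
    have h1 : K.index = Nat.card φ.range := by rw [hK]; exact AddSubgroup.index_ker φ
    have h2 : Nat.card φ.range ≤ Nat.card (Additive (ZMod (2 ^ m))ˣ) :=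
      AddSubgroup.card_le_card_addGroup _
    have h3 : Nat.card (Additive (ZMod (2 ^ m))ˣ) = 2 ^ (m - 1) := by
      change Nat.card (ZMod (2 ^ m))ˣ = 2 ^ (m - 1)
      rw [Nat.card_eq_fintype_card, ZMod.card_units_eq_totient,
        Nat.totient_prime_pow Nat.prime_two (by omega)]
      simp
    have h4 : K.index ≤ 2 ^ (m - 1) := by rw [h1, ← h3]; exact h2
    exact_mod_cast h4
  -- Rankin's bound on the kernel sublattice
  obtain ⟨e, heK, he0, hle⟩ :=
    Literature.Algebra.EuclideanLattices.Rankin.exists_mem_ne_zero_l1_le_of_finiteIndex b K hq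
      (by simp) hρ0 hρ1
  rw [Fintype.card_fin] at hle
  have hdetb : |(Matrix.of ⇑b).det| = d * ∏ i, w i := by
    rw [hbM, hdet, abs_of_pos (mul_pos hd0 hprodw)]
  have hmono : 2 / Rρ * (q * ((K.index : ℝ) * |(Matrix.of ⇑b).det|) / ((1 - ρ ^ q) * V₁))
        ^ (1 / ((n + 1 : ℕ) : ℝ))
      ≤ 2 / Rρ * (q * ((2 : ℝ) ^ (m - 1) * (d * ∏ i, w i)) / ((1 - ρ ^ q) * V₁))
        ^ (1 / ((n + 1 : ℕ) : ℝ)) := by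
    refine mul_le_mul_of_nonneg_left ?_ (by positivity)
    refine Real.rpow_le_rpow (by positivity) ?_ (by positivity)
    refine div_le_div_of_nonneg_right ?_ hden0.le
    refine mul_le_mul_of_nonneg_left ?_ hq0.le
    rw [hdetb]
    exact mul_le_mul_of_nonneg_right hKidx (mul_pos hd0 hprodw).le
  have hle' := hle.trans hmono
  -- coordinates of `v = ∑ e_i b_i`
  have hv : ∀ t, (∑ i, (e i : ℝ) • b i) t = ∑ i, (e i : ℝ) * M i t := by
    intro t
    simp only [Finset.sum_apply, Pi.smul_apply, smul_eq_mul, hb]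
  have hvc : ∀ j : Fin n, (∑ i, (e i : ℝ) • b i) (Fin.castSucc j) = e (Fin.castSucc j) * w j := by
    intro j; rw [hv]; exact brightMatrix_sum_castSucc w d _ j
  have hvl : (∑ i, (e i : ℝ) • b i) (Fin.last n)
      = ∑ i : Fin n, (e (Fin.castSucc i) : ℝ) * w i + e (Fin.last n) * d := by
    rw [hv]; exact brightMatrix_sum_last w d _
  have hl1 : ∑ t, |(∑ i, (e i : ℝ) • b i) t|
      = ∑ j : Fin n, |(e (Fin.castSucc j) : ℝ)| * w j
        + |∑ i : Fin n, (e (Fin.castSucc i) : ℝ) * w i + e (Fin.last n) * d| := by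
    rw [Fin.sum_univ_castSucc]
    congr 1
    · refine Finset.sum_congr rfl fun j _ => ?_
      rw [hvc, abs_mul, abs_of_pos (hw0 j)]
    · rw [hvl]
  -- the last coefficient vanishes (Lemma 2.7)
  have helast : e (Fin.last n) = 0 := by
    by_contra hne
    have h1 : (1 : ℝ) ≤ |(e (Fin.last n) : ℝ)| := by
      rw [← Int.cast_abs]; exact_mod_cast Int.one_le_abs hne
    set T := ∑ i : Fin n, (e (Fin.castSucc i) : ℝ) * w i with hT
    have hTle : |T| ≤ ∑ j : Fin n, |(e (Fin.castSucc j) : ℝ)| * w j := by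
      refine (Finset.abs_sum_le_sum_abs _ _).trans (le_of_eq ?_)
      refine Finset.sum_congr rfl fun j _ => ?_
      rw [abs_mul, abs_of_pos (hw0 j)]
    have hge : d ≤ ∑ t, |(∑ i, (e i : ℝ) • b i) t| := by
      rw [hl1]
      have hE : |(e (Fin.last n) : ℝ) * d| ≤ |T + e (Fin.last n) * d| + |T| := by
        have := abs_sub (T + e (Fin.last n) * d) T
        rwa [add_sub_cancel_left] at this
      calc d ≤ |(e (Fin.last n) : ℝ)| * d := le_mul_of_one_le_left hd0.le h1
        _ = |(e (Fin.last n) : ℝ) * d| := by rw [abs_mul, abs_of_pos hd0]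
        _ ≤ ∑ j : Fin n, |(e (Fin.castSucc j) : ℝ)| * w j + |T + e (Fin.last n) * d| := by
            linarith
    have : d < d := by
      calc d ≤ _ := hge
        _ ≤ _ := hle'
        _ < (n : ℝ) ^ 3 := hB
        _ = d := by rw [hd]
    exact lt_irrefl _ this
  -- the exponent vector on the first `n` coordinates
  set e' : Fin n → ℤ := fun i => e (Fin.castSucc i) with he'
  have he'0 : e' ≠ 0 := by
    intro h0
    apply he0
    funext i
    refine Fin.lastCases ?_ (fun j => ?_) i
    · simpa using helast
    · simpa [he'] using congrFun h0 j
  have hker : ∑ i, e' i • Additive.ofMul (ZMod.unitOfCoprime (p i) (hcop i)) = 0 := by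
    have := heK
    rw [hK, AddMonoidHom.mem_ker, hφ] at this
    exact this
  have hmod : (∏ i, p i ^ (e' i).toNat) ≡ (∏ i, p i ^ (-e' i).toNat) [MOD 2 ^ m] :=
    prod_pow_modEq_of_sum_smul_eq_zero p hcop e' hker
  obtain ⟨a, b', c, habc, hrad, hlog⟩ :=
    exists_abcTriple_of_prod_pow_modEq p hp hinj hm e' he'0 hmod
  refine ⟨a, b', c, habc, hrad, ?_⟩
  rw [hlog]
  have hid : ∑ i, |(e' i : ℝ)| * Real.log (p i) + |∑ i, (e' i : ℝ) * Real.log (p i)|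
      = ∑ t, |(∑ i, (e i : ℝ) • b i) t| := by
    rw [hl1, helast]
    simp [he', hw]
  rw [hid]
  exact hle'

end Literature.NumberTheory.DiophantineGeometry

end
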